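import Summits.QuantumFields.BalabanUV.Beta.CapRouteABoxesReflect
import Summits.QuantumFields.BalabanUV.Beta.TubeZeroFreeFins

/-!
# Beta / ResolventFinCertificate — the FIN LEAF: the character along a fin, the closed-form Lipschitz majorant of a stencil family on a fin
# rectangle, Krawczyk on a fin rectangle, covers; negation symmetry halves the fins
# (β sub-cell, BINDER-OWNERS row CAP-k, lineage `b2b-balaban-beta-an5`, gen 25; node BETA-an5-g25-FINS, leaf 2a; journal CLAIM l.16546)

`TubeZeroFreeFins` (leaf 1, p224731) proved that THEOREM DB's winding datum at a reference slice follows from zero-freeness of the multiplier on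
two 2-real-dimensional FINS, and that for the cell's reflection-invariant `det k₀` the FOUR all-plus fins `{x·e_i + iτκ·(1,1,1,1) : x ∈ [−π, π],
τ ∈ [0, 1]}` suffice.  This leaf states what a certificate of a fin must deliver, in the kernel and BY NAME (the anchors consuming it are
re-issued in the companion `CapRouteAFins`, leaf 2b):

* §1 THE CHARACTER ALONG A FIN: at the fin point `insertNth i (x + iτσ) (iτ·c)` a character factors as `e^{−τ·r}·e^{i R_i x}` with the
  FIN RATE `r = R_i σ + Σ_k R_{succAbove i k} c_k` (`character_fin`); the real mean-value bound `|e^a − e^b| ≤ |a − b|·max(e^a, e^b)`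
  (`abs_exp_sub_exp_le`); hence on a FIN RECTANGLE `|τ − τ₀| ≤ h_τ`, `|x − x₀| ≤ h_x`:
  `‖χ_R(p(τ,x)) − χ_R(p(τ₀,x₀))‖ ≤ e^{−τ₀ r + h_τ|r|}·(|r|·h_τ + |R_i|·h_x)` (`norm_character_fin_sub_le`) and the CLOSED-FORM LIPSCHITZ MAJORANT of
  a stencil family `Σ_R χ_R K[R]` along the fin (`norm_characterSum_fin_sub_le`) — a NUMBER computable from the typed tables, as on a box.
* §2 THE FIN CERTIFICATE (one leaf, order 0): preconditioner `P`, centre residual `‖1 − P·A(p(τ₀,x₀))‖ ≤ θ₀`, Lipschitz majorant `L` on the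
  rectangle, `θ₀ + ‖P‖·L ≤ θ < 1` ⟹ `IsUnit (A p).det ∧ ‖(A p)⁻¹‖ ≤ ‖P‖∕(1−θ)` on the rectangle (`fin_certificate`; Krawczyk =
  `ResolventBoxCertificate.krawczyk`); `lipschitz_fin_of_characterSum`; COVERS of `[0, 1] × [−π, π]` by certified rectangles (`of_fin_cover`).
  Higher-order leaves (`ResolventBoxCertificateTaylor`-style residual sockets) apply verbatim: the per-rectangle conclusion consumed below is only
  `IsUnit (A p).det`.
* `finHyp_of_matNegTranspose`: under the row's binder `MatNegTranspose A` (`det A(−q) = det A(q)`) the fins at slope `+a` through ALL sign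
  patterns give the fins at slope `−a` — the generic (W)-by-fins hypothesis of `TubeZeroFreeFins.windingHyp_of_fins` from `(d+1)·2^d` fins.

HONEST FRAMING.  Kernel glue ([folklore] linear algebra); no rectangle, no preconditioner, no number is supplied; no fin certificate exists;
0 binders instantiated; 0 certified coefficients.  Discharging `BetaPertH` would make Bałaban's ultraviolet stability unconditional — NOT the
continuum limit, NOT the Clay problem.  0 `sorry`, 0 cite tags.
-/

namespace Summit.QuantumFields.BalabanUV.Beta.ResolventFinCertificate

open Complex Set Matrix
open Literature.MathematicalPhysics.QuantumFieldTheory.Balaban1983to89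
open B4Strip (Strip)
open B4ContourShift (latticeKernel)
open B4TorusKernel (descend gridPt)
open Beta.AliasingTailL1 (aliasRatioL1)
open Beta.AliasingTailLattice (codeTheta code16SetE)
open Summit.QuantumFields.BalabanUV.Beta.CapRows (Rows)
open Summit.QuantumFields.BalabanUV.Beta.TubeMaximumModulus
open Summit.QuantumFields.BalabanUV.Beta.VertexToriSymmetry
open Summit.QuantumFields.BalabanUV.Beta.ConjReflectionAlgebra (MatConjSymm)
open Summit.QuantumFields.BalabanUV.Beta.ResolventBoxCertificate (Box krawczyk)
open Summit.QuantumFields.BalabanUV.Beta.PolyRegularAlgebra (character character_insertNth)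
open Summit.QuantumFields.BalabanUV.Beta.CapRouteABoxes (rowsOfOneLoopFormCode16E_routeA₂_ofBoxesRealShift)
open Summit.QuantumFields.BalabanUV.Beta.CapRouteABoxesReflect (rowsOfOneLoopFormCode16E_routeA₂_ofBoxesRealShift_ofReflect)
open scoped Real Matrix.Norms.L2Operator

noncomputable section

variable {d : ℕ} {n : Type*} [Fintype n] [DecidableEq n]

/-! ## §1 The character along a fin; the closed-form Lipschitz majorant on a fin rectangle -/

section Lipschitz

omit [Fintype n] [DecidableEq n] in
/-- **THE CHARACTER ALONG A FIN**: at the fin point `insertNth i (x + iτσ) (iτ·c)` the character of frequency `R` is `e^{−τ r}·e^{i R_i x}` with the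
FIN RATE `r = R_i σ + Σ_k R_{succAbove i k} c_k`. [folklore] -/
theorem character_fin (R : Fin (d + 1) → ℤ) (i : Fin (d + 1)) (σ : ℝ) (c : Fin d → ℝ) (τ x : ℝ) :
    character R (i.insertNth ((x : ℂ) + ((τ * σ : ℝ) : ℂ) * I) fun j => ((τ * c j : ℝ) : ℂ) * I)
      = (Real.exp (-(τ * (R i * σ + ∑ k, (R (i.succAbove k) : ℝ) * c k))) : ℂ) * cexp (I * ((R i * x : ℝ) : ℂ)) := by
  rw [character_insertNth]
  have hs : ∑ k, (R (i.succAbove k) : ℂ) * (((τ * c k : ℝ) : ℂ) * I)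
      = I * (τ : ℂ) * ∑ k, ((R (i.succAbove k) : ℝ) : ℂ) * (c k : ℂ) := by
    rw [Finset.mul_sum]
    refine Finset.sum_congr rfl fun k _ => ?_
    push_cast; ring
  rw [hs, Complex.ofReal_exp, ← Complex.exp_add]
  congr 1
  have e : ((-(τ * (R i * σ + ∑ k, (R (i.succAbove k) : ℝ) * c k)) : ℝ) : ℂ)
      = -((τ : ℂ) * ((R i : ℂ) * (σ : ℂ) + ∑ k, ((R (i.succAbove k) : ℝ) : ℂ) * (c k : ℂ))) := by push_cast; ring
  rw [e]
  push_cast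
  linear_combination ((τ : ℂ) * ((R i : ℂ) * (σ : ℂ) + ∑ k, ((R (i.succAbove k) : ℝ) : ℂ) * (c k : ℂ))) * Complex.I_sq

omit [Fintype n] [DecidableEq n] in
/-- the real mean-value bound `|e^a − e^b| ≤ |a − b| · max (e^a) (e^b)` (from `t + 1 ≤ e^t`). [folklore] -/
theorem abs_exp_sub_exp_le (a b : ℝ) : |Real.exp a - Real.exp b| ≤ |a - b| * max (Real.exp a) (Real.exp b) := by
  -- one-sided form: `b ≤ a ⟹ e^a − e^b ≤ (a − b) e^a`
  have key : ∀ a b : ℝ, b ≤ a → Real.exp a - Real.exp b ≤ (a - b) * Real.exp a := by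
    intro a b hab
    have h1 : (b - a) + 1 ≤ Real.exp (b - a) := Real.add_one_le_exp (b - a)
    have h2 : Real.exp b = Real.exp (b - a) * Real.exp a := by rw [← Real.exp_add]; ring_nf
    rw [h2]
    nlinarith [Real.exp_pos a, h1]
  rcases le_total b a with hab | hab
  · have h0 : 0 ≤ Real.exp a - Real.exp b := sub_nonneg.mpr (Real.exp_le_exp.mpr hab)
    rw [abs_of_nonneg h0, abs_of_nonneg (sub_nonneg.mpr hab)]
    exact (key a b hab).trans (mul_le_mul_of_nonneg_left (le_max_left _ _) (sub_nonneg.mpr hab))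
  · have h0 : Real.exp a - Real.exp b ≤ 0 := sub_nonpos.mpr (Real.exp_le_exp.mpr hab)
    rw [abs_of_nonpos h0, abs_of_nonpos (sub_nonpos.mpr hab), neg_sub, neg_sub]
    exact (key b a hab).trans (mul_le_mul_of_nonneg_left (le_max_right _ _) (sub_nonneg.mpr hab))

omit [Fintype n] [DecidableEq n] in
/-- on `|τ − τ₀| ≤ h`: `max (e^{−τ r}) (e^{−τ₀ r}) ≤ e^{−τ₀ r + h|r|}`. [folklore] -/
theorem max_exp_le_of_abs_sub_le {τ τ₀ h r : ℝ} (hτ : |τ - τ₀| ≤ h) :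
    max (Real.exp (-(τ * r))) (Real.exp (-(τ₀ * r))) ≤ Real.exp (-(τ₀ * r) + h * |r|) := by
  refine max_le (Real.exp_le_exp.mpr ?_) (Real.exp_le_exp.mpr ?_)
  · have h1 : -(τ * r) - -(τ₀ * r) = -((τ - τ₀) * r) := by ring
    have h2 : |-((τ - τ₀) * r)| ≤ h * |r| := by
      rw [abs_neg, abs_mul]; exact mul_le_mul_of_nonneg_right hτ (abs_nonneg _)
    linarith [(abs_le.mp h2).2]
  · have : 0 ≤ h * |r| := mul_nonneg ((abs_nonneg _).trans hτ) (abs_nonneg _)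
    linarith

omit [Fintype n] [DecidableEq n] in
/-- **TWO FIN POINTS ON A FIN RECTANGLE** `|τ − τ₀| ≤ h_τ`, `|x − x₀| ≤ h_x`:
`‖χ_R(p(τ,x)) − χ_R(p(τ₀,x₀))‖ ≤ e^{−τ₀ r + h_τ |r|} · (|r|·h_τ + |R_i|·h_x)`, `r` the fin rate. [folklore] -/
theorem norm_character_fin_sub_le (R : Fin (d + 1) → ℤ) (i : Fin (d + 1)) (σ : ℝ) (c : Fin d → ℝ)
    {τ τ₀ x x₀ hτ hx : ℝ} (hτ' : |τ - τ₀| ≤ hτ) (hx' : |x - x₀| ≤ hx) :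
    ‖character R (i.insertNth ((x : ℂ) + ((τ * σ : ℝ) : ℂ) * I) fun j => ((τ * c j : ℝ) : ℂ) * I)
        - character R (i.insertNth ((x₀ : ℂ) + ((τ₀ * σ : ℝ) : ℂ) * I) fun j => ((τ₀ * c j : ℝ) : ℂ) * I)‖
      ≤ Real.exp (-(τ₀ * (R i * σ + ∑ k, (R (i.succAbove k) : ℝ) * c k)) + hτ * |R i * σ + ∑ k, (R (i.succAbove k) : ℝ) * c k|)
        * (|R i * σ + ∑ k, (R (i.succAbove k) : ℝ) * c k| * hτ + |(R i : ℝ)| * hx) := by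
  set r : ℝ := R i * σ + ∑ k, (R (i.succAbove k) : ℝ) * c k with hr
  rw [character_fin, character_fin]
  set u : ℝ := Real.exp (-(τ * r)) with hu
  set u₀ : ℝ := Real.exp (-(τ₀ * r)) with hu₀
  set φ : ℂ := cexp (I * ((R i * x : ℝ) : ℂ)) with hφ
  set φ₀ : ℂ := cexp (I * ((R i * x₀ : ℝ) : ℂ)) with hφ₀
  set E : ℝ := Real.exp (-(τ₀ * r) + hτ * |r|) with hE
  have hφ1 : ‖φ‖ = 1 := by rw [hφ]; exact Complex.norm_exp_I_mul_ofReal _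
  have hu₀0 : 0 ≤ u₀ := (Real.exp_pos _).le
  have hE0 : 0 ≤ E := (Real.exp_pos _).le
  have hhτ : 0 ≤ hτ := (abs_nonneg _).trans hτ'
  have hhx : 0 ≤ hx := (abs_nonneg _).trans hx'
  -- `uφ − u₀φ₀ = (u − u₀)φ + u₀(φ − φ₀)`
  have e : (u : ℂ) * φ - (u₀ : ℂ) * φ₀ = ((u - u₀ : ℝ) : ℂ) * φ + (u₀ : ℂ) * (φ - φ₀) := by push_cast; ring
  rw [e]
  have h1 : ‖((u - u₀ : ℝ) : ℂ) * φ‖ ≤ E * (|r| * hτ) := by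
    rw [norm_mul, hφ1, mul_one, Complex.norm_real, Real.norm_eq_abs]
    calc |u - u₀| ≤ |(-(τ * r)) - (-(τ₀ * r))| * max u u₀ := abs_exp_sub_exp_le _ _
      _ = (|τ - τ₀| * |r|) * max u u₀ := by
          rw [show -(τ * r) - -(τ₀ * r) = -((τ - τ₀) * r) by ring, abs_neg, abs_mul]
      _ ≤ (hτ * |r|) * E := mul_le_mul (mul_le_mul_of_nonneg_right hτ' (abs_nonneg _))
          (max_exp_le_of_abs_sub_le hτ') (le_max_of_le_left (Real.exp_pos _).le) (mul_nonneg hhτ (abs_nonneg _))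
      _ = E * (|r| * hτ) := by ring
  have h2 : ‖(u₀ : ℂ) * (φ - φ₀)‖ ≤ E * (|(R i : ℝ)| * hx) := by
    rw [norm_mul, Complex.norm_real, Real.norm_of_nonneg hu₀0]
    have hφφ : ‖φ - φ₀‖ ≤ |(R i : ℝ)| * hx := by
      have e2 : φ - φ₀ = φ₀ * (cexp (I * ((R i * x - R i * x₀ : ℝ) : ℂ)) - 1) := by
        rw [hφ, hφ₀, mul_sub, mul_one, ← Complex.exp_add]; push_cast; ring_nf
      rw [e2, norm_mul, hφ₀, Complex.norm_exp_I_mul_ofReal, one_mul]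
      refine (Real.norm_exp_I_mul_ofReal_sub_one_le).trans ?_
      rw [Real.norm_eq_abs, show (R i : ℝ) * x - R i * x₀ = R i * (x - x₀) by ring, abs_mul]
      exact mul_le_mul_of_nonneg_left hx' (abs_nonneg _)
    exact mul_le_mul ((le_max_right u u₀).trans (max_exp_le_of_abs_sub_le hτ')) hφφ (norm_nonneg _) hE0
  have h3 : E * (|r| * hτ) + E * (|(R i : ℝ)| * hx) = E * (|r| * hτ + |(R i : ℝ)| * hx) := by ring
  exact (norm_add_le _ _).trans ((add_le_add h1 h2).trans h3.le)

/-- **THE LIPSCHITZ MAJORANT OF A STENCIL FAMILY ALONG A FIN** (closed form from the tables): on the fin rectangle `|τ − τ₀| ≤ h_τ`,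
`|x − x₀| ≤ h_x`, `‖A p(τ,x) − A p(τ₀,x₀)‖ ≤ Σ_{R ∈ S} e^{−τ₀ r_R + h_τ|r_R|}·(|r_R|·h_τ + |R_i|·h_x)·‖K[R]‖` for `A q = Σ_{R ∈ S} χ_R(q) K[R]`,
`r_R = R_i σ + Σ_k R_{succAbove i k} c_k`. [folklore] -/
theorem norm_characterSum_fin_sub_le (S : Finset (Fin (d + 1) → ℤ)) (K : (Fin (d + 1) → ℤ) → Matrix n n ℂ)
    (i : Fin (d + 1)) (σ : ℝ) (c : Fin d → ℝ) {τ τ₀ x x₀ hτ hx : ℝ} (hτ' : |τ - τ₀| ≤ hτ) (hx' : |x - x₀| ≤ hx) :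
    ‖(∑ R ∈ S, character R (i.insertNth ((x : ℂ) + ((τ * σ : ℝ) : ℂ) * I) fun j => ((τ * c j : ℝ) : ℂ) * I) • K R)
        - ∑ R ∈ S, character R (i.insertNth ((x₀ : ℂ) + ((τ₀ * σ : ℝ) : ℂ) * I) fun j => ((τ₀ * c j : ℝ) : ℂ) * I) • K R‖
      ≤ ∑ R ∈ S, Real.exp (-(τ₀ * (R i * σ + ∑ k, (R (i.succAbove k) : ℝ) * c k))
            + hτ * |R i * σ + ∑ k, (R (i.succAbove k) : ℝ) * c k|)
          * (|R i * σ + ∑ k, (R (i.succAbove k) : ℝ) * c k| * hτ + |(R i : ℝ)| * hx) * ‖K R‖ := by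
  rw [← Finset.sum_sub_distrib]
  refine (norm_sum_le _ _).trans (Finset.sum_le_sum fun R _ => ?_)
  rw [← sub_smul, norm_smul]
  exact mul_le_mul_of_nonneg_right (norm_character_fin_sub_le R i σ c hτ' hx') (norm_nonneg _)

end Lipschitz

/-! ## §2 The fin certificate and covers of the fin rectangle `[0, 1] × [−π, π]` -/

section Fin

variable {A : (Fin (d + 1) → ℂ) → Matrix n n ℂ}

/-- **THE FIN CERTIFICATE** (one leaf, order 0): on the fin through `iτ·c` at coordinate `i` with slope `σ`, a preconditioner `P`, a centre residual
`‖1 − P·A(p(τ₀,x₀))‖ ≤ θ₀`, a Lipschitz majorant `‖A p(τ,x) − A p(τ₀,x₀)‖ ≤ L` on the rectangle `|τ − τ₀| ≤ h_τ`, `|x − x₀| ≤ h_x`, and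
`θ₀ + ‖P‖·L ≤ θ < 1` ⟹ on the whole rectangle `A p(τ,x)` is invertible (`IsUnit det`) with `‖(A p)⁻¹‖ ≤ ‖P‖∕(1−θ)`. [folklore] -/
theorem fin_certificate (i : Fin (d + 1)) (σ : ℝ) (c : Fin d → ℝ) {τ₀ x₀ hτ hx : ℝ} (P : Matrix n n ℂ) {θ₀ L θ : ℝ}
    (hcentre : ‖1 - P * A (i.insertNth ((x₀ : ℂ) + ((τ₀ * σ : ℝ) : ℂ) * I) fun j => ((τ₀ * c j : ℝ) : ℂ) * I)‖ ≤ θ₀)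
    (hLip : ∀ τ x : ℝ, |τ - τ₀| ≤ hτ → |x - x₀| ≤ hx →
      ‖A (i.insertNth ((x : ℂ) + ((τ * σ : ℝ) : ℂ) * I) fun j => ((τ * c j : ℝ) : ℂ) * I)
        - A (i.insertNth ((x₀ : ℂ) + ((τ₀ * σ : ℝ) : ℂ) * I) fun j => ((τ₀ * c j : ℝ) : ℂ) * I)‖ ≤ L)
    (hθ : θ₀ + ‖P‖ * L ≤ θ) (hθ1 : θ < 1) :
    ∀ τ x : ℝ, |τ - τ₀| ≤ hτ → |x - x₀| ≤ hx →
      IsUnit (A (i.insertNth ((x : ℂ) + ((τ * σ : ℝ) : ℂ) * I) fun j => ((τ * c j : ℝ) : ℂ) * I)).det ∧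
        ‖(A (i.insertNth ((x : ℂ) + ((τ * σ : ℝ) : ℂ) * I) fun j => ((τ * c j : ℝ) : ℂ) * I))⁻¹‖ ≤ ‖P‖ / (1 - θ) := by
  intro τ x hτ' hx'
  set M := A (i.insertNth ((x : ℂ) + ((τ * σ : ℝ) : ℂ) * I) fun j => ((τ * c j : ℝ) : ℂ) * I) with hM
  set M₀ := A (i.insertNth ((x₀ : ℂ) + ((τ₀ * σ : ℝ) : ℂ) * I) fun j => ((τ₀ * c j : ℝ) : ℂ) * I) with hM₀
  have hres : ‖1 - P * M‖ ≤ θ := by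
    have e : 1 - P * M = (1 - P * M₀) + P * (M₀ - M) := by rw [Matrix.mul_sub]; abel
    calc ‖1 - P * M‖ = ‖(1 - P * M₀) + P * (M₀ - M)‖ := by rw [e]
      _ ≤ ‖1 - P * M₀‖ + ‖P * (M₀ - M)‖ := norm_add_le _ _
      _ ≤ θ₀ + ‖P‖ * ‖M₀ - M‖ := add_le_add hcentre (l2_opNorm_mul _ _)
      _ ≤ θ₀ + ‖P‖ * L := by gcongr; rw [norm_sub_rev]; exact hLip τ x hτ' hx'
      _ ≤ θ := hθ
  exact krawczyk hres hθ1

/-- the Lipschitz hypothesis of `fin_certificate` for a STENCIL FAMILY, from the closed-form majorant of §1. [folklore] -/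
theorem lipschitz_fin_of_characterSum (S : Finset (Fin (d + 1) → ℤ)) (K : (Fin (d + 1) → ℤ) → Matrix n n ℂ)
    (i : Fin (d + 1)) (σ : ℝ) (c : Fin d → ℝ) (τ₀ x₀ hτ hx : ℝ) {L : ℝ}
    (hL : ∑ R ∈ S, Real.exp (-(τ₀ * (R i * σ + ∑ k, (R (i.succAbove k) : ℝ) * c k))
            + hτ * |R i * σ + ∑ k, (R (i.succAbove k) : ℝ) * c k|)
          * (|R i * σ + ∑ k, (R (i.succAbove k) : ℝ) * c k| * hτ + |(R i : ℝ)| * hx) * ‖K R‖ ≤ L) :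
    ∀ τ x : ℝ, |τ - τ₀| ≤ hτ → |x - x₀| ≤ hx →
      ‖(∑ R ∈ S, character R (i.insertNth ((x : ℂ) + ((τ * σ : ℝ) : ℂ) * I) fun j => ((τ * c j : ℝ) : ℂ) * I) • K R)
        - ∑ R ∈ S, character R (i.insertNth ((x₀ : ℂ) + ((τ₀ * σ : ℝ) : ℂ) * I) fun j => ((τ₀ * c j : ℝ) : ℂ) * I) • K R‖ ≤ L :=
  fun _ _ hτ' hx' => (norm_characterSum_fin_sub_le S K i σ c hτ' hx').trans hL

omit [Fintype n] [DecidableEq n] in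
/-- **COVER OF A FIN**: finitely many rectangles covering `[0, 1] × [−π, π]`, each carrying a pointwise certificate `Q`, certify `Q` on the whole
fin parameter rectangle. [folklore] -/
theorem of_fin_cover {ι : Type*} (rects : Finset ι) (τc xc hτ hx : ι → ℝ) {Q : ℝ → ℝ → Prop}
    (hcov : ∀ τ ∈ Icc (0 : ℝ) 1, ∀ x ∈ Icc (-π) π, ∃ b ∈ rects, |τ - τc b| ≤ hτ b ∧ |x - xc b| ≤ hx b)
    (hcert : ∀ b ∈ rects, ∀ τ x : ℝ, |τ - τc b| ≤ hτ b → |x - xc b| ≤ hx b → Q τ x) :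
    ∀ τ ∈ Icc (0 : ℝ) 1, ∀ x ∈ Icc (-π) π, Q τ x := by
  intro τ hτ' x hx'
  obtain ⟨b, hb, h1, h2⟩ := hcov τ hτ' x hx'
  exact hcert b hb τ x h1 h2

/-- **NEGATION SYMMETRY HALVES THE FINS**: under the row's binder `MatNegTranspose A` (`A(−q) = A(q)ᵀ`, so `det A(−q) = det A(q)`), fins at slope
`+a` through ALL sign patterns give the fins at slope `−a` (the point of slope `−a`, pattern `s`, abscissa `x` is minus the point of slope `+a`,
pattern `−s`, abscissa `−x`) — the generic (W)-by-fins hypothesis from `(d+1)·2^d` fins. [folklore] -/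
theorem finHyp_of_matNegTranspose {a : ℝ} (hAn : MatNegTranspose A)
    (hfin : ∀ (i : Fin (d + 1)) (s : Fin d → ℝ), (∀ j, s j = 1 ∨ s j = -1) →
      ∀ τ ∈ Icc (0 : ℝ) 1, ∀ x ∈ Icc (-π) π,
        IsUnit (A (i.insertNth ((x : ℂ) + ((τ * a : ℝ) : ℂ) * I) fun j => ((τ * (s j * a) : ℝ) : ℂ) * I)).det) :
    ∀ (i : Fin (d + 1)) (s : Fin d → ℝ), (∀ j, s j = 1 ∨ s j = -1) → ∀ σ : ℝ, |σ| = |a| →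
      ∀ τ ∈ Icc (0 : ℝ) 1, ∀ x ∈ Icc (-π) π,
        (A (i.insertNth ((x : ℂ) + ((τ * σ : ℝ) : ℂ) * I) fun j => ((τ * (s j * a) : ℝ) : ℂ) * I)).det ≠ 0 := by
  intro i s hs σ hσ τ hτ x hx
  rcases abs_eq_abs.mp hσ with e | e
  · rw [e]; exact (hfin i s hs τ hτ x hx).ne_zero
  · -- slope `−a`: the point is `−(point of slope +a, pattern −s, abscissa −x)`
    have hs' : ∀ j, -s j = 1 ∨ -s j = -1 := fun j => by
      rcases hs j with h | h
      · right; rw [h]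
      · left; rw [h, neg_neg]
    have hx' : -x ∈ Icc (-π) π := ⟨by linarith [hx.2], by linarith [hx.1]⟩
    have hU := hfin i (fun j => -s j) hs' τ hτ (-x) hx'
    have ept : (i.insertNth ((x : ℂ) + ((τ * σ : ℝ) : ℂ) * I) (fun j => ((τ * (s j * a) : ℝ) : ℂ) * I) : Fin (d + 1) → ℂ)
        = -(i.insertNth (((-x : ℝ) : ℂ) + ((τ * a : ℝ) : ℂ) * I) (fun j => ((τ * (-s j * a) : ℝ) : ℂ) * I) : Fin (d + 1) → ℂ) := by
      funext μ
      refine Fin.succAboveCases i ?_ ?_ μ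
      · rw [Pi.neg_apply, Fin.insertNth_apply_same, Fin.insertNth_apply_same, e]; push_cast; ring
      · intro k
        rw [Pi.neg_apply, Fin.insertNth_apply_succAbove, Fin.insertNth_apply_succAbove]; push_cast; ring
    rw [ept, hAn, Matrix.det_transpose]
    exact hU.ne_zero

end Fin

end

end Summit.QuantumFields.BalabanUV.Beta.ResolventFinCertificate
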